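import Summits.BirchSwinnertonDyer.BirchSwinnertonDyer.Theorems.ThetaPartnerAtTwoSignedControlAtTwoShaThreeBaseH3Units
import Summits.BirchSwinnertonDyer.BirchSwinnertonDyer.Theorems.GenusKolyvaginAtTwoVisiblePairAtTwoCasselsTateCanonical
import Literature.NumberTheory.GaloisRepresentations.LocalDualityTheorem
import HarnessLib

/-!
# Route `GenusKolyvaginAtTwo`, crux `KolyvaginExactAtTwo` (22137) → Q3-inner, Cassels–Tate block at the EVEN level:
# the input `hH3` — `Ш³(K, μ_n) = 0` — DISCHARGED for every number field and every level

Seat `bsd-line-gk2-p2` g13 (cell `bsd-f1-sign2`). THEOREMS ONLY (no definition, no named fact, no `sorry`).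

The Cassels–Tate recipe of the tree (`ctLevelPairing`, Milne I Prop. 6.9) displays, at level `m`, the input
`hH3 : ∀ c : H³(K, μ_{m²}), (∀ v, loc_v c = 0) → c = 0` (Milne I Thm. 4.10 (c): `β³ : H³(K, M) ⥲ ⊕_{v real} H³(K_v, M)`).
At ODD prime-power level the whole group `H³(K, μ)` vanishes (`cd_p Γ_K ≤ 2`, the tree's
`CasselsTateLemma615OfPT.galoisCohomology_three_mu_eq_zero_of_ne_two`); at the EVEN level over a field with a real place it
does not (`H³(ℝ, μ_{2^k}) = ℤ/2`), and `hH3` is exactly the injectivity half of 4.10 (c)₃ — which the tree PROVES for every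
number field: `ShaThreeBrauer.poitouTate_three_realPlaces_injective_holds` (cell `bsd-wall`, from `H³(Γ_F, F̄ˣ) = 0`, Tate).
This file records the consequences in the Cassels–Tate currency:

* `shaThree_eq_zero` — any finite discrete `Γ_K`-module `M`: a class of `H³(K, M)` vanishing at every place is `0`;
* `shaThree_mu_eq_zero` — THE displayed `hH3` for `μ_n`, every `n ≥ 1`, every number field;
* (over a totally complex `K` the whole group `H³(K, M)` vanishes: `CasselsTatePTc.galoisCohomology_three_eq_zero_of_isTotallyComplex'`,
  sibling file `…CasselsTatePTcTotallyComplex`);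
* `selmer_eq_and_card_selmer_twin_eq_of_canonical_levelPairings` — the `ℚ`-pair capstone
  `selmer_eq_and_card_selmer_twin_eq_of_canonical` (p665926) with `hH3` DISCHARGED (`K = ℚ`, `n = 2^L · 2^L`): what stays
  displayed is the Weil-pairing data, the level-pairing property `hB₁`/`hB₂` at the even level (Cassels' alternation — LEAD
  gk2-p1's lane — and the Poitou–Tate inputs `hPTc`/`h615`), `hx` and gk2-p3's level-`2` inputs.

BSD is not proved by any of this.

References: [MilneADT2006] I Thm. 4.10 (c), §6 Prop. 6.9, Thm. 6.13 (a); [CasselsFrohlichANT1967] Ch. VII §11.4 (Tate,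
`H³(G_K, K̄ˣ) = 0`); [McCallumLMS1991] §5 Thm. 5.4.
-/

set_option linter.dupNamespace false -- tree convention: `Summit.BirchSwinnertonDyer.BirchSwinnertonDyer.Theorems` (summit = sub-problem)
set_option autoImplicit false

noncomputable section

open scoped Classical

namespace Summit.BirchSwinnertonDyer.BirchSwinnertonDyer.Theorems.GenusExact.VisiblePairAtTwo

open WeierstrassCurve NumberField IsDedekindDomain Field Function Rat.HeightOneSpectrum
open Literature.NumberTheory.EllipticCurves Literature.NumberTheory.GaloisRepresentations
open Literature.NumberTheory.GaloisCohomology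
open Literature.NumberTheory.GaloisRepresentations.DiscreteGaloisModule (mu MuCarrier)
open Literature.NumberTheory.EllipticCurves.KolyvaginDescent
open Literature.GroupTheory.FiniteAbelian

section ShaThree

variable (K : Type) [Field K] [NumberField K]

/-- **`Ш³(K, M) = 0` for a finite discrete `Γ_K`-module** (Milne I Thm. 4.10 (c), `r = 3`): a class of `H³(K, M)` whose
localisation vanishes at every place (the real ones suffice) is `0` — the tree theorem
`ShaThreeBrauer.poitouTate_three_realPlaces_injective_holds`. [cite: MilneADT2006, Ch. I, Thm. 4.10 (c)] -/
theorem shaThree_eq_zero {M : Type} [AddCommGroup M] [TopologicalSpace M] [DiscreteTopology M] [Finite M]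
    (ρ : DiscreteGaloisModule K M) (c : galoisCohomology ρ 3)
    (hc : ∀ v : Place K, galoisCohomology.localization ρ v 3 c = 0) : c = 0 :=
  SignedEC.ShaThreeBrauer.poitouTate_three_realPlaces_injective_holds K M ρ c fun w _ => hc (Sum.inl w)

/-- **THE displayed input `hH3` of the tree's Cassels–Tate recipe, for every number field and every level**:
`Ш³(K, μ_n) = 0` — a class of `H³(K, μ_n)` vanishing at every place is `0`. [cite: MilneADT2006, Ch. I, Thm. 4.10 (c)] -/
theorem shaThree_mu_eq_zero (n : ℕ) [NeZero n] :
    ∀ c : galoisCohomology (mu K n) 3, (∀ v : Place K, galoisCohomology.localization (mu K n) v 3 c = 0) → c = 0 := by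
  haveI : Finite (MuCarrier K n) := finite_muCarrier K n
  exact fun c hc => shaThree_eq_zero K (mu K n) c hc

end ShaThree

section Capstone

variable {W : WeierstrassCurve ℚ} [W.IsElliptic] [W.IsGloballyMinimal] {K : Type} [Field K] [NumberField K]
  {L : ℕ} {θ : K} {hθ : θ ∉ Set.range (algebraMap ℚ K)}
  {hθsq : θ ^ 2 = algebraMap ℚ K ((NumberField.discr K : ℤ) : ℚ)} [(twin W K).IsElliptic]

/-- **Exactness of the `ℚ`-pair instance for the Cassels–Tate pairings of THE invariant maps, `hH3` DISCHARGED**: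
`selmer_eq_and_card_selmer_twin_eq_of_canonical` with `Ш³(ℚ, μ_{2^L·2^L}) = 0` supplied by `shaThree_mu_eq_zero`.
`Sel_{2^M}(E/ℚ) = ℤ/2^M · x` and `#Sel_{2^M}(E^{(d_K)}/ℚ) = 2^{2M₀}` at `M = L + L`, `2M₀ ≤ L`.
[cite: McCallumLMS1991, §4 Prop. 4.7, §5 Lemma 5.3 and Thm. 5.4] [cite: MilneADT2006, Ch. I Thm. 4.10 (b)(c), §6 Prop. 6.9] -/
theorem selmer_eq_and_card_selmer_twin_eq_of_canonical_levelPairings (I : Input W K (L + L) hθ hθsq)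
    (I₁ : Input W K 1 hθ hθsq)
    (hcm : ¬ W.HasCM) (hΔ : W.Δ < 0) (hK : IsImaginaryQuadratic K) (hodd : Odd (NumberField.discr K))
    (hns : ¬ IsSquare ((NumberField.discr K : ℚ) * -|W.Δ|))
    (hρ : ∀ n : ℕ, W.HasSurjectiveModNGaloisRep (2 ^ n : ℕ)) (hL : 2 * I.M₀ ≤ L) (hL1 : 1 ≤ L)
    -- the Weil pairings on `E[2^L · 2^L]` and `E^{(d_K)}[2^L · 2^L]`
    (e₁ : geomTorsion W ((2 ^ L * 2 ^ L : ℕ) : ℤ) → geomTorsion W ((2 ^ L * 2 ^ L : ℕ) : ℤ) → AlgebraicClosure ℚ)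
    (hμ₁ : ∀ S T, e₁ S T ^ (2 ^ L * 2 ^ L) = 1)
    (hadd₁₁ : ∀ S₁ S₂ T, e₁ (S₁ + S₂) T = e₁ S₁ T * e₁ S₂ T)
    (hadd₂₁ : ∀ S T₁ T₂, e₁ S (T₁ + T₂) = e₁ S T₁ * e₁ S T₂)
    (hgal₁ : ∀ (σ : absoluteGaloisGroup ℚ) (S T : geomTorsion W ((2 ^ L * 2 ^ L : ℕ) : ℤ)),
      σ • e₁ S T = e₁ (σ • S) (σ • T))
    (halt₁ : ∀ T, e₁ T T = 1) (hnondeg₁ : ∀ T, (∀ S, e₁ S T = 1) → T = 0)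
    (e₂ : geomTorsion (twin W K) ((2 ^ L * 2 ^ L : ℕ) : ℤ) → geomTorsion (twin W K) ((2 ^ L * 2 ^ L : ℕ) : ℤ) →
      AlgebraicClosure ℚ)
    (hμ₂ : ∀ S T, e₂ S T ^ (2 ^ L * 2 ^ L) = 1)
    (hadd₁₂ : ∀ S₁ S₂ T, e₂ (S₁ + S₂) T = e₂ S₁ T * e₂ S₂ T)
    (hadd₂₂ : ∀ S T₁ T₂, e₂ S (T₁ + T₂) = e₂ S T₁ * e₂ S T₂)
    (hgal₂ : ∀ (σ : absoluteGaloisGroup ℚ) (S T : geomTorsion (twin W K) ((2 ^ L * 2 ^ L : ℕ) : ℤ)),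
      σ • e₂ S T = e₂ (σ • S) (σ • T))
    (halt₂ : ∀ T, e₂ T T = 1) (hnondeg₂ : ∀ T, (∀ S, e₂ S T = 1) → T = 0)
    (hB₁ : IsLevelPairing (2 ^ L) (ctLevelPairing W (2 ^ L) e₁ hμ₁ hadd₁₁ hadd₂₁ hgal₁
      (LocalInvariants.canonical ℚ (2 ^ L * 2 ^ L)) halt₁
      (sumInvLocalizationEqZero_canonical_of_numberField ℚ (2 ^ L * 2 ^ L)) (shaThree_mu_eq_zero ℚ (2 ^ L * 2 ^ L))
      (localTerm_finite_support (W := W) (m := 2 ^ L) (e := e₁) (hμ := hμ₁) (hadd₁ := hadd₁₁) (hadd₂ := hadd₂₁)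
        (hgal := hgal₁) halt₁ (LocalInvariants.canonical ℚ (2 ^ L * 2 ^ L)))))
    (hB₂ : IsLevelPairing (2 ^ L) (ctLevelPairing (twin W K) (2 ^ L) e₂ hμ₂ hadd₁₂ hadd₂₂ hgal₂
      (LocalInvariants.canonical ℚ (2 ^ L * 2 ^ L)) halt₂
      (sumInvLocalizationEqZero_canonical_of_numberField ℚ (2 ^ L * 2 ^ L)) (shaThree_mu_eq_zero ℚ (2 ^ L * 2 ^ L))
      (localTerm_finite_support (W := twin W K) (m := 2 ^ L) (e := e₂) (hμ := hμ₂) (hadd₁ := hadd₁₂)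
        (hadd₂ := hadd₂₂) (hgal := hgal₂) halt₂ (LocalInvariants.canonical ℚ (2 ^ L * 2 ^ L)))))
    (hx : torsionH1ToH1 W (lvl (L + L)) I.x = 0)
    -- the shallow certificate, in class form, and the remaining level-`2` inputs
    {ℓ₀ : ℕ} (hkol₀ : kolPrime W K 1 ℓ₀) (hy0 : I₁.c₂ ℓ₀ ≠ 0) (h0 : I₁.c₁ 1 = 0)
    (h44ord : ∀ ℓ, kolPrime W K (L + L) ℓ → ℓ ≠ ℓ₀ →
      (I₁.c₁ (ℓ * ℓ₀) ∈ a₁ W 1 ℓ₀ ↔ I₁.c₂ ℓ ∈ a₂ W K 1 ℓ₀))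
    (hι : ∀ ℓ, kolPrime W K (L + L) ℓ → torsionH1OfDvd (twin W K) (lvl_one_dvd_lvl (hL1.trans (Nat.le_add_right L L)))
      (I₁.c₂ ℓ) = ((2 : ℤ) ^ (L + L - 1)) • I.c₂ ℓ) :
    selmerGroup W (lvl (L + L)) = AddSubgroup.zmultiples I.x ∧
      Nat.card (selmerGroup (twin W K) (lvl (L + L))) = 2 ^ (2 * I.M₀) :=
  selmer_eq_and_card_selmer_twin_eq_of_canonical I I₁ hcm hΔ hK hodd hns hρ hL hL1 e₁ hμ₁ hadd₁₁ hadd₂₁ hgal₁ halt₁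
    hnondeg₁ e₂ hμ₂ hadd₁₂ hadd₂₂ hgal₂ halt₂ hnondeg₂ (shaThree_mu_eq_zero ℚ (2 ^ L * 2 ^ L)) hB₁ hB₂ hx hkol₀ hy0 h0
    h44ord hι

end Capstone

end Summit.BirchSwinnertonDyer.BirchSwinnertonDyer.Theorems.GenusExact.VisiblePairAtTwo

end
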